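import Mathlib.Data.Set.Card
import Mathlib.Analysis.Normed.Lp.MeasurableSpace
import Literature.MathematicalPhysics.StatisticalMechanics.HcpSiteGeometry
import Literature.Probability.Process.PointStationaryLaw
import Summits.AtomisticToContinuum.Crystallization.Theorems.EnergyDerivativeOrderLimitTransferHcpShells
import HarnessLib

/-!
# Crux `TwelveWithinOne` (stmt-AtomisticToContinuum-15808, route `SquareWellLayerCake`), line `Sketch`:
# K2 with inward slack at the root of a rotated relaxed hcp crystal

Stub `stub_hcpRootGeometry` of the checked skeleton of line `Sketch` (pure hcp geometry).  For
`0 < σ`, in-layer bond `a` and interlayer bond `b = √(a²/3 + h²)` both in `[55/57 + σ, 1 − σ]`, `0 < h`,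
and a linear isometry `A` of `ℝ³`, the configuration `count|A(hcpStacking a h)` satisfies:

* every atom is `(55/57 + σ)`-separated from every other atom: two distinct sites of the relaxed hcp
  stacking are at squared distance `a²`, `a²/3 + h²`, or at least one of `3a²`, `4a²/3 + h²`, `4h²`
  (`EnergyDerivativeOrderLimitTransfer.dist_sq_cases_of_mem`), and all five are `≥ (55/57 + σ)²`
  (`4h² ≥ 4(b² − a²/3) ≥ (55/57 + σ)²` since `3·(55/57) > 2`); `A` preserves distances;
* the twelve first-shell sites of the root (six at distance `a`, six at distance `b`) are atoms `w ≠ 0`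
  with `‖w‖ ≤ 1 − σ`: with `ρ = 1 − σ` one has `max a b ≤ ρ` and `ρ² ≤ 1 <` each of `3a²`, `a² + b²`,
  `4h²`, so `EnergyDerivativeOrderLimitTransfer.ncard_shell` gives exactly twelve sites `≠ 0` within `ρ`
  of the root `0`; their `A`-images form `T`.

Atoms of `count|S` are the points of `S` (`Literature.Probability.Process.count_restrict_singleton_ne_zero_iff`).
-/

noncomputable section

open MeasureTheory Set

namespace Summit.AtomisticToContinuum.Crystallization.Theorems.SquareWellLayerCakeTwelveWithinOne

open Literature.MathematicalPhysics.StatisticalMechanics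
open Literature.Probability.Process (count_restrict_singleton_ne_zero_iff)
open Summit.AtomisticToContinuum.Crystallization.Theorems.EnergyDerivativeOrderLimitTransfer
  (dist_sq_cases_of_mem ncard_shell)

/-- **Numeric side conditions of the certified bond box.**  If `m = 55/57 + σ ≤ a ≤ 1 − σ`,
`m ≤ √(a²/3 + h²) ≤ 1 − σ` and `0 < σ`, then `m² ≤ a²/3 + h²`, `m² ≤ 4h²`, and with `ρ = 1 − σ`:
`ρ² < 3a²`, `ρ² < 4a²/3 + h²`, `ρ² < 4h²`. [folklore] -/
theorem bondBox_numerics {σ a h : ℝ} (hσ : 0 < σ) (ha1 : 55 / 57 + σ ≤ a) (ha2 : a ≤ 1 - σ)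
    (hb1 : 55 / 57 + σ ≤ Real.sqrt (a ^ 2 / 3 + h ^ 2))
    (hb2 : Real.sqrt (a ^ 2 / 3 + h ^ 2) ≤ 1 - σ) :
    (55 / 57 + σ) ^ 2 ≤ a ^ 2 / 3 + h ^ 2 ∧ (55 / 57 + σ) ^ 2 ≤ 4 * h ^ 2 ∧
      (1 - σ) ^ 2 < 3 * a ^ 2 ∧ (1 - σ) ^ 2 < 4 * a ^ 2 / 3 + h ^ 2 ∧ (1 - σ) ^ 2 < 4 * h ^ 2 := by
  have hm0 : (0 : ℝ) < 55 / 57 + σ := by positivity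
  have hmsq : (55 / 57 + σ) ^ 2 ≤ a ^ 2 / 3 + h ^ 2 := (Real.le_sqrt' hm0).1 hb1
  have hbsq : a ^ 2 / 3 + h ^ 2 ≤ (1 - σ) ^ 2 := (Real.sqrt_le_iff.1 hb2).2
  have ha0 : 0 < a := hm0.trans_le ha1
  have hale : a ≤ 1 := by linarith
  have hasq : a ^ 2 ≤ 1 := by nlinarith
  have hρsq : (1 - σ) ^ 2 < 1 := by nlinarith
  have hm2 : (55 / 57 : ℝ) ^ 2 ≤ (55 / 57 + σ) ^ 2 := by nlinarith
  have hma : (55 / 57 + σ) ^ 2 ≤ a ^ 2 := by nlinarith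
  refine ⟨hmsq, ?_, ?_, ?_, ?_⟩
  · nlinarith
  · nlinarith
  · nlinarith
  · nlinarith

/-- **Separation of the relaxed hcp stacking in the bond box**: two distinct sites of
`hcpStacking a h` are at distance `≥ 55/57 + σ`. [folklore] -/
theorem le_dist_of_mem_hcpStacking {σ a h : ℝ} (hσ : 0 < σ) (ha1 : 55 / 57 + σ ≤ a) (ha2 : a ≤ 1 - σ)
    (hb1 : 55 / 57 + σ ≤ Real.sqrt (a ^ 2 / 3 + h ^ 2))
    (hb2 : Real.sqrt (a ^ 2 / 3 + h ^ 2) ≤ 1 - σ) {x y : EuclideanSpace ℝ (Fin 3)}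
    (hx : x ∈ hcpStacking a h) (hy : y ∈ hcpStacking a h) (hxy : x ≠ y) :
    55 / 57 + σ ≤ dist x y := by
  obtain ⟨hmsq, hm4, -, -, -⟩ := bondBox_numerics hσ ha1 ha2 hb1 hb2
  have hm0 : (0 : ℝ) < 55 / 57 + σ := by positivity
  have hma : (55 / 57 + σ) ^ 2 ≤ a ^ 2 := pow_le_pow_left₀ hm0.le ha1 2
  have hsq : (55 / 57 + σ) ^ 2 ≤ dist x y ^ 2 := by
    rcases dist_sq_cases_of_mem isHaggSeq_alternating hx hy hxy with hd | hd | hd | hd | hd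
    · rw [hd]; exact hma
    · rw [hd]; exact hmsq
    · nlinarith [sq_nonneg a]
    · nlinarith [sq_nonneg a]
    · exact hm4.trans hd
  exact (pow_le_pow_iff_left₀ hm0.le dist_nonneg two_ne_zero).1 hsq

/-- **STUB `stub_hcpRootGeometry` (pure hcp geometry)** — K2 WITH SLACK AT THE ROOT OF A ROTATED hcp
CRYSTAL: if `a` and `√(a²/3+h²)` lie in `[55/57 + σ, 1 − σ]` (`0 < σ ≤ 1/100`, `h > 0`) then in
`count|A(hcpStacking a h)` every atom `w` with `‖w‖ ≤ 11/10 + σ` is `(55/57 + σ)`-separated from every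
other atom (indeed ALL pairs are), and the twelve first-shell sites of the root (six at distance `a`,
six at `√(a²/3+h²)`) are atoms `w ≠ 0` with `‖w‖ ≤ 1 − σ`. [folklore] -/
theorem stub_hcpRootGeometry :
    ∀ σ a h : ℝ, 0 < σ → σ ≤ 1 / 100 →
      55 / 57 + σ ≤ a → a ≤ 1 - σ →
      55 / 57 + σ ≤ Real.sqrt (a ^ 2 / 3 + h ^ 2) → Real.sqrt (a ^ 2 / 3 + h ^ 2) ≤ 1 - σ → 0 < h →
      ∀ A : EuclideanSpace ℝ (Fin 3) ≃ₗᵢ[ℝ] EuclideanSpace ℝ (Fin 3),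
      (∀ w : EuclideanSpace ℝ (Fin 3),
          (Measure.count : Measure (EuclideanSpace ℝ (Fin 3))).restrict (A '' hcpStacking a h) {w} ≠ 0 →
          ‖w‖ ≤ 11 / 10 + σ →
          ∀ w' : EuclideanSpace ℝ (Fin 3),
            (Measure.count : Measure (EuclideanSpace ℝ (Fin 3))).restrict (A '' hcpStacking a h) {w'} ≠ 0 →
            w' ≠ w → 55 / 57 + σ ≤ dist w w') ∧
        ∃ T : Finset (EuclideanSpace ℝ (Fin 3)), T.card = 12 ∧
          ∀ w ∈ T, (Measure.count : Measure (EuclideanSpace ℝ (Fin 3))).restrict (A '' hcpStacking a h) {w} ≠ 0 ∧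
            w ≠ 0 ∧ ‖w‖ ≤ 1 - σ := by
  intro σ a h hσ _ ha1 ha2 hb1 hb2 hh A
  refine ⟨?_, ?_⟩
  · -- (i) separation: `A` is an isometry and the stacking is `(55/57 + σ)`-separated
    intro w hw _ w' hw' hne
    rw [count_restrict_singleton_ne_zero_iff] at hw hw'
    obtain ⟨x, hx, rfl⟩ := hw
    obtain ⟨x', hx', rfl⟩ := hw'
    rw [LinearIsometryEquiv.dist_map]
    exact le_dist_of_mem_hcpStacking hσ ha1 ha2 hb1 hb2 hx hx' fun hxx' => hne (by rw [hxx'])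
  · -- (ii) the twelve first-shell sites of the root, rotated by `A`
    obtain ⟨-, -, hρ1, hρ2, hρ3⟩ := bondBox_numerics hσ ha1 ha2 hb1 hb2
    have ha0 : 0 < a := by linarith
    have h0 : (0 : EuclideanSpace ℝ (Fin 3)) ∈ hcpStacking a h :=
      ⟨0, 0, 0, (barlowPos_alternating_zero a h).symm⟩
    set Sh : Set (EuclideanSpace ℝ (Fin 3)) :=
      {w | w ∈ hcpStacking a h ∧ w ≠ 0 ∧ dist (0 : EuclideanSpace ℝ (Fin 3)) w ≤ 1 - σ} with hSh
    have hcard : Sh.ncard = 12 :=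
      ncard_shell isHaggSeq_alternating ha0 hh.ne' ha2 hb2 hρ1 hρ2 hρ3 h0
    have hfin : Sh.Finite := Set.finite_of_ncard_ne_zero (by rw [hcard]; norm_num)
    refine ⟨hfin.toFinset.image A, ?_, ?_⟩
    · rw [Finset.card_image_of_injective _ A.injective, ← Set.ncard_eq_toFinset_card Sh hfin, hcard]
    · intro w hw
      rw [Finset.mem_image] at hw
      obtain ⟨x, hx, rfl⟩ := hw
      rw [Set.Finite.mem_toFinset] at hx
      obtain ⟨hxS, hx0, hxd⟩ := hx
      refine ⟨(count_restrict_singleton_ne_zero_iff _ _).2 ⟨x, hxS, rfl⟩, ?_, ?_⟩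
      · intro hAx
        exact hx0 (A.injective (by rw [hAx, LinearIsometryEquiv.map_zero]))
      · rw [LinearIsometryEquiv.norm_map, ← dist_zero_left]
        exact hxd

end Summit.AtomisticToContinuum.Crystallization.Theorems.SquareWellLayerCakeTwelveWithinOne

end
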